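import Summits.QuantumFields.BalabanUV.Beta.GAN24.WrecAtEvenHalfRows
import Summits.QuantumFields.BalabanUV.Beta.GAN24.WSlotParityJunction

/-!
# `BalabanUV.Beta.GAN24.WrecAtEvenHalfRowsFinal` — binder row G-an2-4 ∕ (CONV-C), W-slot EXIT (α) (RULING R-gan24p1-g33-1 (C2), `ALPHA0-STATUS` link L9), PART 2 of
# `WrecAtEvenHalfRows`: **AT `d = 3` THE W-SLOT ROWS OF THE EVEN HALF OF `WrecAt` — AND ROAD FP's D1 LITERAL OF RECORD — AS FUNCTIONS OF THE EVEN MEMBER's TWO T₂ ROWS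
# «T2Shape^{ev}» ∧ «T2Drift^{ev}» ALONE** (the dressed K-slot, the S-slot, the mixed table and the border's class DISCHARGED by tree theorems)

NOT IN PRINT; OUR BOOKKEEPING (road-P2 chair of row G-an2-4, unit `b2b-balaban-gan24-p2` gen 45, crux team (2); journal `CLAIMS.log` [GAN24P2-G45-INTENT1]).  HONEST FRAMING
(cell contract, verbatim): «discharging `BetaPertH` makes Bałaban's UV stability UNCONDITIONAL — a real constructive-QFT result; it is NOT the continuum limit and NOT the
Clay problem.»  HONEST DEPENDENCY (verbatim): «continuum YM on T⁴ ⇐ BetaPertH ∧ nine spine estimates (0/9 proved); BetaPertH ⇐ (D1) ∧ (D4) ∧ CAP+tail; G-an2-4 gates asym,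
D1 and NE2/3/4.»

WHAT ([folklore] compositions BY NAME; 0 `def`, 0 cited facts, 0 `def … : Prop`, 0 sorry): §1 `hW_hWall_evenHalf_WrecAt_three_of_rows` ∕ `…_of_srecAt_rows` — PART 1's
`hW_hWall_evenHalf_WrecAt_of_shapes` with the dressed K-rows (road P1's `KSlotAssembly.convCKWall_holds` ⨾ asym1's `HessKerCoDressedBmWall.exists_coDressedBm_unit_rows`), the mixed
table (an1's `MixedJetTablesPlug.hmix_an1`) and the S-slot (MY `WrecAtSlotRows.exists_spureRecAt_rows_three_of_srecAt_rows`) discharged; §2 **`hW_hWall_evenHalf_WrecAt_three_of_T2ev`**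
(`Lc ≥ 2`, pin `cE = Lc⁴`, every `cVH cΛ cE₂ cB T`, every `LocStencil₂` border, every in-block root): the S-slot rows are the OWNER gan24-p1 g22's
`SrecAtSlotRowsFinal.exists_hS_hSall_SrecAt_three` (TREE) ⟹ (hW, hWall) OF THE EVEN HALF ⟸ «T2Shape^{ev}» ∧ «T2Drift^{ev}» ALONE; §3
**`exists_allScalesSeq_JsRowD1Pin_of_T2ev`** (`Lc` odd, `Lc ≥ 2`, colour `N`): leaf-01 g71's parity-blind D1 END `WSlotParityJunction.exists_allScalesSeq_JsRowD1Pin_of_slots_evenHalf`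
FED — ROAD FP's D1 LITERAL OF RECORD `∃ κ θ, 0 ≤ θ < 1 ∧ AllScalesSeq (j ↦ secondMoment (TbalOf Lc (JsRowD1Pin hLc N) j) μ ν) κ θ` ⟸ «T2Shape^{ev}» ∧ «T2Drift^{ev}» OF THE EVEN
MEMBER `½ • (T̃_j + P T̃_j)` AT THE LITERAL's TABLES, AND NOTHING ELSE (the even-member twin of MY gen-35 `WrecAtSlotRowsFinal.exists_allScalesSeq_JsRowD1Pin_of_T2`).
READING (zero weight): the (α-0) chain's consumer side is complete — D1 literal ⟸ [§3] «T2Shape^{ev}» ∧ «T2Drift^{ev}» ⟸ [the OWNER's (α-END) `T2ShapeEvenEnd` + its drift twin]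
`hb` ∧ `hZ` (∧ `hcell` ∧ `hC`).  CONDITIONAL on `hT₂ ∕ hT₂d` — displayed, NOT discharged.  NOT «W-slot closed», NOT «D1 closed»; NEVER «G-an2-4 closed» as (CONV-C); NOT
`BetaPertH`, NOT continuum, NOT Clay; not in print — our bookkeeping.  2026-08-23.
-/

noncomputable section

open Finset
open scoped BigOperators
open Literature.MathematicalPhysics.QuantumFieldTheory
open Literature.MathematicalPhysics.QuantumFieldTheory.Balaban1983to89
open Literature.MathematicalPhysics.QuantumFieldTheory.Balaban1983to89.Beta
open RemainderConstAllScales (AllScalesSeq)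
open ExpKernelCalculus (MKer Decays BiLoc VertexFamily VertexFamily₂)
open OneStepResolventKernel (Fib LocStencil)
open OneStepKernelFamily (KInvStep TbalOf)
open AffineAveraging (box toSite)
open AveragingContoursRooted (ctrOff ctrOff_mem_box)
open AveragingMixedJetTables (mixFFAt mixFFAt_inl_inr mixFFAt_inr)
open WilsonVertex2Sym (wsym22)
open BalabanStepJets (vertexFamily₂_mono)
open BalabanCompositeJets (LocStencil₂)
open SecondOrderResponse (LocStencilFM)
open Summit.QuantumFields.BalabanUV.Beta.TameKernelCalculus (trK)
open Summit.QuantumFields.BalabanUV.Beta.BorderedHessian (sgnK)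
open Summit.QuantumFields.BalabanUV.Beta.HessKerDressedUnits (unitK unitS unitW)
open Summit.QuantumFields.BalabanUV.Beta.SecondOrderUnits (unitS₂)
open Summit.QuantumFields.BalabanUV.Beta.AxialDressingRooted (coDressKBmAt)
open Summit.QuantumFields.BalabanUV.Beta.SpineRooted (SpureRecAt T2RecAt WrecAt)
open Summit.QuantumFields.BalabanUV.Beta.WardLocusRecursive (SrecAt)
open Summit.QuantumFields.BalabanUV.Beta.SecondOrderSocketIdentification (vh₂SAn1)
open Summit.QuantumFields.BalabanUV.Beta.SecondOrderTableLawEnd (locStencil₂_vh₂SAn1)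
open Summit.QuantumFields.BalabanUV.Beta.RowD1JointEnd (JsRowD1Pin)
open Summit.QuantumFields.BalabanUV.Beta.HessKerCoDressedBmWall (exists_coDressedBm_unit_rows)
open Summit.QuantumFields.BalabanUV.Beta.MixedJetTablesPlug (hmix_an1)
open Summit.QuantumFields.BalabanUV.Beta.GAN24.CombesThomas (sfStep smStep sfStep_ne_zero smStep_ne_zero)
open Summit.QuantumFields.BalabanUV.Beta.GAN24.KSlotAssembly (convCKWall_holds)
open Summit.QuantumFields.BalabanUV.Beta.GAN24.WrecAtSlotRows (exists_spureRecAt_rows_three_of_srecAt_rows)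
open Summit.QuantumFields.BalabanUV.Beta.GAN24.SrecAtSlotRowsFinal (exists_hS_hSall_SrecAt_three exists_hS_hSall_SrecAt_ctr)
open Summit.QuantumFields.BalabanUV.Beta.GAN24.WSlotParityJunction (exists_allScalesSeq_JsRowD1Pin_of_slots_evenHalf)
open Summit.QuantumFields.BalabanUV.Beta.GAN24.WrecAtEvenHalfRows (hW_hWall_evenHalf_WrecAt_of_shapes)

namespace Summit.QuantumFields.BalabanUV.Beta.GAN24.WrecAtEvenHalfRowsFinal

variable {Lc : ℕ} [NeZero Lc] {r : Fin (3 + 1) → ℕ}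

/-! ## §1 `d = 3`, `Lc ≥ 2`, an1's rooted mixed table: the even-half W-rows wait on «S′Shape» ∧ «S′Drift» and «T2Shape^{ev}» ∧ «T2Drift^{ev}» only -/

/-- NOT IN PRINT; OUR PROOF ATTEMPT — A SOCKET (`d = 3`, `2 ≤ Lc`, in-block root `r`, an1's rooted mixed table `mixFFAt (toSite r) Lc`; every colour constant, every Wilson
position table `T`, every `LocStencil₂` second-order border `vh₂S`).  **THE W-SLOT ROWS (hW, hWall) OF THE EVEN HALF OF `WrecAt` FROM «S′Shape» ∧ «S′Drift» AND «T2Shape^{ev}» ∧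
«T2Drift^{ev}» ALONE**: the dressed K-rows are asym1's `HessKerCoDressedBmWall.exists_coDressedBm_unit_rows` over road P1's `KSlotAssembly.convCKWall_holds` (TREE, hypothesis-free),
the mixed-table letters an1's `MixedJetTablesPlug.hmix_an1` ∕ `mixFFAt_inl_inr` ∕ `mixFFAt_inr` — exactly as in MY gen-35 `WrecAtSlotOfShapes.hW_hWall_WrecAt_three_of_rows`. -/
theorem hW_hWall_evenHalf_WrecAt_three_of_rows (hLc : 2 ≤ Lc) (hr : r ∈ box (3 + 1) Lc) (cE cVH cΛ cE₂ cB : ℝ) (T : Fin 4 → Fin 4 → Fin 4 → Fin 4 → ℝ)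
    {vh₂S : Fin (3 + 1) → (Fin (3 + 1) → ℤ) → Fin (3 + 1) → (Fin (3 + 1) → ℤ) → MKer (3 + 1) (Fib 3)} (hB : ∃ C δ : ℝ, 0 < δ ∧ LocStencil₂ vh₂S C δ)
    {Cs cS θS δs : ℝ} (hS : ∀ j, LocStencil (unitS (sfStep Lc j) (smStep 3 Lc j) (SpureRecAt 3 Lc (toSite r) cE cVH cΛ j)) Cs δs)
    (hSall : ∀ k j, LocStencil (unitS (sfStep Lc (k + j)) (smStep 3 Lc (k + j)) (SpureRecAt 3 Lc (toSite r) cE cVH cΛ (k + j)) -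
      unitS (sfStep Lc k) (smStep 3 Lc k) (SpureRecAt 3 Lc (toSite r) cE cVH cΛ k)) (cS * θS ^ k) δs)
    (hδs : 0 < δs) (hθS0 : 0 ≤ θS) (hθS1 : θS < 1)
    {C₂ c₂ θ₂ δ₂ : ℝ}
    (hT₂ : ∀ j, LocStencil₂ (((1 : ℝ) / 2) • (unitS₂ (sfStep Lc j) (smStep 3 Lc j) (T2RecAt 3 Lc (toSite r) cE cVH cΛ cE₂ cB T vh₂S (mixFFAt (toSite r) Lc) j) +
      fun κ u κ' u' => sgnK (trK (unitS₂ (sfStep Lc j) (smStep 3 Lc j) (T2RecAt 3 Lc (toSite r) cE cVH cΛ cE₂ cB T vh₂S (mixFFAt (toSite r) Lc) j) κ u κ' u')))) C₂ δ₂)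
    (hT₂d : ∀ k j, LocStencil₂ (((1 : ℝ) / 2) • (unitS₂ (sfStep Lc (k + j)) (smStep 3 Lc (k + j)) (T2RecAt 3 Lc (toSite r) cE cVH cΛ cE₂ cB T vh₂S (mixFFAt (toSite r) Lc) (k + j)) +
        fun κ u κ' u' => sgnK (trK (unitS₂ (sfStep Lc (k + j)) (smStep 3 Lc (k + j)) (T2RecAt 3 Lc (toSite r) cE cVH cΛ cE₂ cB T vh₂S (mixFFAt (toSite r) Lc) (k + j)) κ u κ' u'))) -
      ((1 : ℝ) / 2) • (unitS₂ (sfStep Lc k) (smStep 3 Lc k) (T2RecAt 3 Lc (toSite r) cE cVH cΛ cE₂ cB T vh₂S (mixFFAt (toSite r) Lc) k) +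
        fun κ u κ' u' => sgnK (trK (unitS₂ (sfStep Lc k) (smStep 3 Lc k) (T2RecAt 3 Lc (toSite r) cE cVH cΛ cE₂ cB T vh₂S (mixFFAt (toSite r) Lc) k) κ u κ' u')))) (c₂ * θ₂ ^ k) δ₂)
    (hδ₂ : 0 < δ₂) (hθ₂0 : 0 ≤ θ₂) (hθ₂1 : θ₂ < 1) :
    ∃ Cw cW θW δW : ℝ, 0 ≤ θW ∧ θW < 1 ∧ 0 < δW ∧
      (∀ j, VertexFamily₂ (unitW (sfStep Lc j) (smStep 3 Lc j) (fun μ y ν y' => ((1 : ℝ) / 2) •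
        (WrecAt 3 Lc (toSite r) cE cVH cΛ cE₂ cB T vh₂S (mixFFAt (toSite r) Lc) j μ y ν y' +
          sgnK (trK (WrecAt 3 Lc (toSite r) cE cVH cΛ cE₂ cB T vh₂S (mixFFAt (toSite r) Lc) j μ y ν y'))))) Lc Cw δW) ∧
      (∀ k j, VertexFamily₂ (unitW (sfStep Lc (k + j)) (smStep 3 Lc (k + j)) (fun μ y ν y' => ((1 : ℝ) / 2) •
          (WrecAt 3 Lc (toSite r) cE cVH cΛ cE₂ cB T vh₂S (mixFFAt (toSite r) Lc) (k + j) μ y ν y' +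
            sgnK (trK (WrecAt 3 Lc (toSite r) cE cVH cΛ cE₂ cB T vh₂S (mixFFAt (toSite r) Lc) (k + j) μ y ν y')))) -
        unitW (sfStep Lc k) (smStep 3 Lc k) (fun μ y ν y' => ((1 : ℝ) / 2) •
          (WrecAt 3 Lc (toSite r) cE cVH cΛ cE₂ cB T vh₂S (mixFFAt (toSite r) Lc) k μ y ν y' +
            sgnK (trK (WrecAt 3 Lc (toSite r) cE cVH cΛ cE₂ cB T vh₂S (mixFFAt (toSite r) Lc) k μ y ν y'))))) Lc (cW * θW ^ k) δW) := by
  have hLc1 : 1 ≤ Lc := by omega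
  -- road P1's K-pair, transported through asym1's block-mean co-dressing socket
  obtain ⟨C, δK, cK, θK, hδK, hθK0, hθK1, hK, hKall⟩ := convCKWall_holds (Lc := Lc) hLc
  obtain ⟨c, -, hG, hGall⟩ := exists_coDressedBm_unit_rows hLc1 hr (sfStep Lc) (smStep 3 Lc) sfStep_ne_zero smStep_ne_zero
    (K := fun j => KInvStep (d := 3) Lc j) hδK hK hKall
  -- an1's rooted mixed table
  obtain ⟨CM₂, δ₄, hδ₄, hmix⟩ := hmix_an1 (d := 3) (Lc := Lc) hLc1 hr
  exact hW_hWall_evenHalf_WrecAt_of_shapes hLc1 hr hG hGall (by positivity) hθK0 hθK1 cE cVH cΛ cE₂ cB T hB hS hSall hδs hθS0 hθS1 hT₂ hT₂d hδ₂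
    hθ₂0 hθ₂1 hmix hδ₄
    (fun κ u ρ' w x z α μ' => mixFFAt_inl_inr (toSite r) Lc κ u ρ' w x z α μ') (fun κ u ρ' w x z μ' b => mixFFAt_inr (toSite r) Lc κ u ρ' w x z μ' b)

/-- NOT IN PRINT; OUR PROOF ATTEMPT — A SOCKET (`d = 3`, `2 ≤ Lc`, in-block root; every `cE cVH cΛ cE₂ cB T`, every `LocStencil₂` border `vh₂S`).  **THE EVEN-HALF W-SLOT ROWS
FROM THE S-SLOT ROWS (hS, hSall) OF THE COMB FAMILY `SrecAt` AND «T2Shape^{ev}» ∧ «T2Drift^{ev}» ALONE** (§1 ∘ MY `WrecAtSlotRows.exists_spureRecAt_rows_three_of_srecAt_rows`). -/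
theorem hW_hWall_evenHalf_WrecAt_three_of_srecAt_rows (hLc : 2 ≤ Lc) (hr : r ∈ box (3 + 1) Lc) (cE cVH cΛ cE₂ cB : ℝ)
    (T : Fin 4 → Fin 4 → Fin 4 → Fin 4 → ℝ) {vh₂S : Fin (3 + 1) → (Fin (3 + 1) → ℤ) → Fin (3 + 1) → (Fin (3 + 1) → ℤ) → MKer (3 + 1) (Fib 3)}
    (hB : ∃ C δ : ℝ, 0 < δ ∧ LocStencil₂ vh₂S C δ) {Cs cS θS δS : ℝ}
    (hS : ∀ j, LocStencil (unitS (sfStep Lc j) (smStep 3 Lc j) (SrecAt 3 Lc (toSite r) cE cVH cΛ j)) Cs δS)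
    (hSall : ∀ k j, LocStencil (unitS (sfStep Lc (k + j)) (smStep 3 Lc (k + j)) (SrecAt 3 Lc (toSite r) cE cVH cΛ (k + j)) -
      unitS (sfStep Lc k) (smStep 3 Lc k) (SrecAt 3 Lc (toSite r) cE cVH cΛ k)) (cS * θS ^ k) δS)
    (hδS : 0 < δS) (hθS0 : 0 ≤ θS) (hθS1 : θS < 1)
    {C₂ c₂ θ₂ δ₂ : ℝ}
    (hT₂ : ∀ j, LocStencil₂ (((1 : ℝ) / 2) • (unitS₂ (sfStep Lc j) (smStep 3 Lc j) (T2RecAt 3 Lc (toSite r) cE cVH cΛ cE₂ cB T vh₂S (mixFFAt (toSite r) Lc) j) +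
      fun κ u κ' u' => sgnK (trK (unitS₂ (sfStep Lc j) (smStep 3 Lc j) (T2RecAt 3 Lc (toSite r) cE cVH cΛ cE₂ cB T vh₂S (mixFFAt (toSite r) Lc) j) κ u κ' u')))) C₂ δ₂)
    (hT₂d : ∀ k j, LocStencil₂ (((1 : ℝ) / 2) • (unitS₂ (sfStep Lc (k + j)) (smStep 3 Lc (k + j)) (T2RecAt 3 Lc (toSite r) cE cVH cΛ cE₂ cB T vh₂S (mixFFAt (toSite r) Lc) (k + j)) +
        fun κ u κ' u' => sgnK (trK (unitS₂ (sfStep Lc (k + j)) (smStep 3 Lc (k + j)) (T2RecAt 3 Lc (toSite r) cE cVH cΛ cE₂ cB T vh₂S (mixFFAt (toSite r) Lc) (k + j)) κ u κ' u'))) -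
      ((1 : ℝ) / 2) • (unitS₂ (sfStep Lc k) (smStep 3 Lc k) (T2RecAt 3 Lc (toSite r) cE cVH cΛ cE₂ cB T vh₂S (mixFFAt (toSite r) Lc) k) +
        fun κ u κ' u' => sgnK (trK (unitS₂ (sfStep Lc k) (smStep 3 Lc k) (T2RecAt 3 Lc (toSite r) cE cVH cΛ cE₂ cB T vh₂S (mixFFAt (toSite r) Lc) k) κ u κ' u')))) (c₂ * θ₂ ^ k) δ₂)
    (hδ₂ : 0 < δ₂) (hθ₂0 : 0 ≤ θ₂) (hθ₂1 : θ₂ < 1) :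
    ∃ Cw cW θW δW : ℝ, 0 ≤ θW ∧ θW < 1 ∧ 0 < δW ∧
      (∀ j, VertexFamily₂ (unitW (sfStep Lc j) (smStep 3 Lc j) (fun μ y ν y' => ((1 : ℝ) / 2) •
        (WrecAt 3 Lc (toSite r) cE cVH cΛ cE₂ cB T vh₂S (mixFFAt (toSite r) Lc) j μ y ν y' +
          sgnK (trK (WrecAt 3 Lc (toSite r) cE cVH cΛ cE₂ cB T vh₂S (mixFFAt (toSite r) Lc) j μ y ν y'))))) Lc Cw δW) ∧
      (∀ k j, VertexFamily₂ (unitW (sfStep Lc (k + j)) (smStep 3 Lc (k + j)) (fun μ y ν y' => ((1 : ℝ) / 2) •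
          (WrecAt 3 Lc (toSite r) cE cVH cΛ cE₂ cB T vh₂S (mixFFAt (toSite r) Lc) (k + j) μ y ν y' +
            sgnK (trK (WrecAt 3 Lc (toSite r) cE cVH cΛ cE₂ cB T vh₂S (mixFFAt (toSite r) Lc) (k + j) μ y ν y')))) -
        unitW (sfStep Lc k) (smStep 3 Lc k) (fun μ y ν y' => ((1 : ℝ) / 2) •
          (WrecAt 3 Lc (toSite r) cE cVH cΛ cE₂ cB T vh₂S (mixFFAt (toSite r) Lc) k μ y ν y' +
            sgnK (trK (WrecAt 3 Lc (toSite r) cE cVH cΛ cE₂ cB T vh₂S (mixFFAt (toSite r) Lc) k μ y ν y'))))) Lc (cW * θW ^ k) δW) := by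
  obtain ⟨Cs', cS', θ', δ', hθ'0, hθ'1, hδ', hS', hSall'⟩ :=
    exists_spureRecAt_rows_three_of_srecAt_rows hLc hr cE cVH cΛ hS hSall hδS hθS0 hθS1
  exact hW_hWall_evenHalf_WrecAt_three_of_rows hLc hr cE cVH cΛ cE₂ cB T hB hS' hSall' hδ' hθ'0 hθ'1 hT₂ hT₂d hδ₂ hθ₂0 hθ₂1

/-! ## §2 The S-slot discharged at the pin `cE = Lc⁴`: (hW, hWall) of the even half from «T2Shape^{ev}» ∧ «T2Drift^{ev}» ALONE -/

/-- NOT IN PRINT; OUR PROOF ATTEMPT ([folklore] composition: §1 ∘ the OWNER gan24-p1 g22's `SrecAtSlotRowsFinal.exists_hS_hSall_SrecAt_three`).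
**THE W-SLOT ROWS OF THE EVEN HALF OF THE `d = 3` COMB FAMILY `WrecAt` FROM «T2Shape^{ev}» ∧ «T2Drift^{ev}» ALONE** (`Lc ≥ 2`, pin `cE = Lc^{3+1}`, every `cVH cΛ cE₂ cB T`,
every `LocStencil₂` border `vh₂S`, every in-block root): if the EVEN MEMBER `½ • (T̃_j + P T̃_j)` of the normalised T₂ tower `T̃_j = unitS₂_j (T2RecAt 3 Lc (toSite r) … j)` is a
`LocStencil₂` family uniformly in `j` (`hT₂`) with geometrically Cauchy consecutive differences (`hT₂d`), then the even half of the W-literal has both wall rows: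
`∃ Cw cW θW δW, 0 ≤ θW ∧ θW < 1 ∧ 0 < δW ∧ (∀ j, VertexFamily₂ (unitW_j ((W⁰_j)^{ev})) Lc Cw δW) ∧ (∀ k j, VertexFamily₂ (unitW_{k+j} ((W⁰_{k+j})^{ev}) − unitW_k ((W⁰_k)^{ev})) Lc (cW·θW^k) δW)`.
The even-carrier twin of MY gen-35 `WrecAtSlotRowsFinal.hW_hWall_WrecAt_three_of_T2`; ONLY the two even-member T₂ rows are displayed ((α-END), OPEN). -/
theorem hW_hWall_evenHalf_WrecAt_three_of_T2ev (hLc : 2 ≤ Lc) {cE : ℝ} (hcE : cE = (Lc : ℝ) ^ (3 + 1)) (hr : r ∈ box (3 + 1) Lc) (cVH cΛ cE₂ cB : ℝ)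
    (T : Fin 4 → Fin 4 → Fin 4 → Fin 4 → ℝ) {vh₂S : Fin (3 + 1) → (Fin (3 + 1) → ℤ) → Fin (3 + 1) → (Fin (3 + 1) → ℤ) → MKer (3 + 1) (Fib 3)}
    (hB : ∃ C δ : ℝ, 0 < δ ∧ LocStencil₂ vh₂S C δ) {C₂ c₂ θ₂ δ₂ : ℝ}
    (hT₂ : ∀ j, LocStencil₂ (((1 : ℝ) / 2) • (unitS₂ (sfStep Lc j) (smStep 3 Lc j) (T2RecAt 3 Lc (toSite r) cE cVH cΛ cE₂ cB T vh₂S (mixFFAt (toSite r) Lc) j) +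
      fun κ u κ' u' => sgnK (trK (unitS₂ (sfStep Lc j) (smStep 3 Lc j) (T2RecAt 3 Lc (toSite r) cE cVH cΛ cE₂ cB T vh₂S (mixFFAt (toSite r) Lc) j) κ u κ' u')))) C₂ δ₂)
    (hT₂d : ∀ k j, LocStencil₂ (((1 : ℝ) / 2) • (unitS₂ (sfStep Lc (k + j)) (smStep 3 Lc (k + j)) (T2RecAt 3 Lc (toSite r) cE cVH cΛ cE₂ cB T vh₂S (mixFFAt (toSite r) Lc) (k + j)) +
        fun κ u κ' u' => sgnK (trK (unitS₂ (sfStep Lc (k + j)) (smStep 3 Lc (k + j)) (T2RecAt 3 Lc (toSite r) cE cVH cΛ cE₂ cB T vh₂S (mixFFAt (toSite r) Lc) (k + j)) κ u κ' u'))) -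
      ((1 : ℝ) / 2) • (unitS₂ (sfStep Lc k) (smStep 3 Lc k) (T2RecAt 3 Lc (toSite r) cE cVH cΛ cE₂ cB T vh₂S (mixFFAt (toSite r) Lc) k) +
        fun κ u κ' u' => sgnK (trK (unitS₂ (sfStep Lc k) (smStep 3 Lc k) (T2RecAt 3 Lc (toSite r) cE cVH cΛ cE₂ cB T vh₂S (mixFFAt (toSite r) Lc) k) κ u κ' u')))) (c₂ * θ₂ ^ k) δ₂)
    (hδ₂ : 0 < δ₂) (hθ₂0 : 0 ≤ θ₂) (hθ₂1 : θ₂ < 1) :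
    ∃ Cw cW θW δW : ℝ, 0 ≤ θW ∧ θW < 1 ∧ 0 < δW ∧
      (∀ j, VertexFamily₂ (unitW (sfStep Lc j) (smStep 3 Lc j) (fun μ y ν y' => ((1 : ℝ) / 2) •
        (WrecAt 3 Lc (toSite r) cE cVH cΛ cE₂ cB T vh₂S (mixFFAt (toSite r) Lc) j μ y ν y' +
          sgnK (trK (WrecAt 3 Lc (toSite r) cE cVH cΛ cE₂ cB T vh₂S (mixFFAt (toSite r) Lc) j μ y ν y'))))) Lc Cw δW) ∧
      (∀ k j, VertexFamily₂ (unitW (sfStep Lc (k + j)) (smStep 3 Lc (k + j)) (fun μ y ν y' => ((1 : ℝ) / 2) •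
          (WrecAt 3 Lc (toSite r) cE cVH cΛ cE₂ cB T vh₂S (mixFFAt (toSite r) Lc) (k + j) μ y ν y' +
            sgnK (trK (WrecAt 3 Lc (toSite r) cE cVH cΛ cE₂ cB T vh₂S (mixFFAt (toSite r) Lc) (k + j) μ y ν y')))) -
        unitW (sfStep Lc k) (smStep 3 Lc k) (fun μ y ν y' => ((1 : ℝ) / 2) •
          (WrecAt 3 Lc (toSite r) cE cVH cΛ cE₂ cB T vh₂S (mixFFAt (toSite r) Lc) k μ y ν y' +
            sgnK (trK (WrecAt 3 Lc (toSite r) cE cVH cΛ cE₂ cB T vh₂S (mixFFAt (toSite r) Lc) k μ y ν y'))))) Lc (cW * θW ^ k) δW) := by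
  obtain ⟨Cs, cS, θS, δS, hθS0, hθS1, hδS, hall⟩ := exists_hS_hSall_SrecAt_three hLc hcE cVH cΛ
  obtain ⟨hS, hSall⟩ := hall r hr
  exact hW_hWall_evenHalf_WrecAt_three_of_srecAt_rows hLc hr cE cVH cΛ cE₂ cB T hB hS hSall hδS hθS0 hθS1 hT₂ hT₂d hδ₂ hθ₂0 hθ₂1

/-! ## §3 Road FP's D1 literal of record from the two EVEN-MEMBER T₂ rows alone -/

/-- NOT IN PRINT; OUR PROOF ATTEMPT ([folklore] composition: leaf-01 g71's `WSlotParityJunction.exists_allScalesSeq_JsRowD1Pin_of_slots_evenHalf` ∘ the OWNER's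
`SrecAtSlotRowsFinal.exists_hS_hSall_SrecAt_ctr` ∘ §2 ∘ d1-formalise-leaf-06's `SecondOrderTableLawEnd.locStencil₂_vh₂SAn1`; `ALPHA0-STATUS` link L9, RULING R-gan24p1-g33-1 (C2)).
**ROAD FP's D1 LITERAL OF RECORD MODULO THE EVEN MEMBER's TWO T₂ ROWS ONLY** (`Lc` odd, `Lc ≥ 2`, colour `N`): the four row binders `hS hSall hW hWall` of the parity-blind D1 END
(`WSlotParityBlind` ⨾ `WSlotParityJunction`: the W-slot rows are asked of the EVEN HALF `½ • (W⁰_j + sgnK (trK W⁰_j))` only) DISCHARGED down to «T2Shape^{ev}» `hT₂` ∧ «T2Drift^{ev}» `hT₂d`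
of the EVEN MEMBER `½ • (T̃_j + P T̃_j)`, `T̃_j = unitS₂_j (T2RecAt 3 Lc ρ_c Lc⁴ (−Lc⁸∕2) (2∕Lc⁴) Lc⁸ (−Lc¹²∕4) ((8N²)⁻¹ • wsym22 N) (vh₂SAn1 Lc) (mixFFAt ρ_c Lc) j)`, `ρ_c = toSite (ctrOff 4 Lc)`
— the OWNER's `T2ShapeEvenEnd` member at `ε = 1` (`one_smul`) —; conclusion VERBATIM the literal's: `∃ κ θ, 0 ≤ θ ∧ θ < 1 ∧ AllScalesSeq (j ↦ secondMoment (TbalOf Lc (JsRowD1Pin hLc N) j) μ ν) κ θ`.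
The even-member twin of MY gen-35 `WrecAtSlotRowsFinal.exists_allScalesSeq_JsRowD1Pin_of_T2`: after the parity re-cut (α-0) the residual of the D1 literal on the G-an2-4 side is the
EVEN member's «T2Shape^{ev}» ∧ «T2Drift^{ev}» — the ODD half ((β) of record) is never read.  CONDITIONAL on `hT₂ ∕ hT₂d` — displayed, NOT discharged.  NOT «W-slot closed»,
NOT «D1 closed»; NEVER «G-an2-4 closed» as (CONV-C); NOT `BetaPertH`, NOT continuum, NOT Clay; not in print. -/
theorem exists_allScalesSeq_JsRowD1Pin_of_T2ev (hLc : Odd Lc) (hL2 : 2 ≤ Lc) (N : ℕ) {C₂ c₂ θ₂ δ₂ : ℝ}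
    (hT₂ : ∀ j, LocStencil₂ (((1 : ℝ) / 2) • (unitS₂ (sfStep Lc j) (smStep 3 Lc j)
        (T2RecAt 3 Lc (toSite (ctrOff (3 + 1) Lc)) ((Lc : ℝ) ^ 4) (-((Lc : ℝ) ^ 8 / 2)) (2 / (Lc : ℝ) ^ 4) ((Lc : ℝ) ^ 8) (-((Lc : ℝ) ^ 12 / 4))
          ((8 * (N : ℝ) ^ 2)⁻¹ • wsym22 N) (vh₂SAn1 Lc) (mixFFAt (toSite (ctrOff (3 + 1) Lc)) Lc) j) +
      fun κ u κ' u' => sgnK (trK (unitS₂ (sfStep Lc j) (smStep 3 Lc j)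
        (T2RecAt 3 Lc (toSite (ctrOff (3 + 1) Lc)) ((Lc : ℝ) ^ 4) (-((Lc : ℝ) ^ 8 / 2)) (2 / (Lc : ℝ) ^ 4) ((Lc : ℝ) ^ 8) (-((Lc : ℝ) ^ 12 / 4))
          ((8 * (N : ℝ) ^ 2)⁻¹ • wsym22 N) (vh₂SAn1 Lc) (mixFFAt (toSite (ctrOff (3 + 1) Lc)) Lc) j) κ u κ' u')))) C₂ δ₂)
    (hT₂d : ∀ k j, LocStencil₂ (((1 : ℝ) / 2) • (unitS₂ (sfStep Lc (k + j)) (smStep 3 Lc (k + j))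
          (T2RecAt 3 Lc (toSite (ctrOff (3 + 1) Lc)) ((Lc : ℝ) ^ 4) (-((Lc : ℝ) ^ 8 / 2)) (2 / (Lc : ℝ) ^ 4) ((Lc : ℝ) ^ 8) (-((Lc : ℝ) ^ 12 / 4))
            ((8 * (N : ℝ) ^ 2)⁻¹ • wsym22 N) (vh₂SAn1 Lc) (mixFFAt (toSite (ctrOff (3 + 1) Lc)) Lc) (k + j)) +
        fun κ u κ' u' => sgnK (trK (unitS₂ (sfStep Lc (k + j)) (smStep 3 Lc (k + j))
          (T2RecAt 3 Lc (toSite (ctrOff (3 + 1) Lc)) ((Lc : ℝ) ^ 4) (-((Lc : ℝ) ^ 8 / 2)) (2 / (Lc : ℝ) ^ 4) ((Lc : ℝ) ^ 8) (-((Lc : ℝ) ^ 12 / 4))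
            ((8 * (N : ℝ) ^ 2)⁻¹ • wsym22 N) (vh₂SAn1 Lc) (mixFFAt (toSite (ctrOff (3 + 1) Lc)) Lc) (k + j)) κ u κ' u'))) -
      ((1 : ℝ) / 2) • (unitS₂ (sfStep Lc k) (smStep 3 Lc k)
          (T2RecAt 3 Lc (toSite (ctrOff (3 + 1) Lc)) ((Lc : ℝ) ^ 4) (-((Lc : ℝ) ^ 8 / 2)) (2 / (Lc : ℝ) ^ 4) ((Lc : ℝ) ^ 8) (-((Lc : ℝ) ^ 12 / 4))
            ((8 * (N : ℝ) ^ 2)⁻¹ • wsym22 N) (vh₂SAn1 Lc) (mixFFAt (toSite (ctrOff (3 + 1) Lc)) Lc) k) +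
        fun κ u κ' u' => sgnK (trK (unitS₂ (sfStep Lc k) (smStep 3 Lc k)
          (T2RecAt 3 Lc (toSite (ctrOff (3 + 1) Lc)) ((Lc : ℝ) ^ 4) (-((Lc : ℝ) ^ 8 / 2)) (2 / (Lc : ℝ) ^ 4) ((Lc : ℝ) ^ 8) (-((Lc : ℝ) ^ 12 / 4))
            ((8 * (N : ℝ) ^ 2)⁻¹ • wsym22 N) (vh₂SAn1 Lc) (mixFFAt (toSite (ctrOff (3 + 1) Lc)) Lc) k) κ u κ' u')))) (c₂ * θ₂ ^ k) δ₂)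
    (hδ₂ : 0 < δ₂) (hθ₂0 : 0 ≤ θ₂) (hθ₂1 : θ₂ < 1) (μ ν : Fin 4) :
    ∃ κ θ : ℝ, 0 ≤ θ ∧ θ < 1 ∧ AllScalesSeq (fun j => B12Beta.secondMoment (TbalOf Lc (JsRowD1Pin hLc N) j) μ ν) κ θ := by
  obtain ⟨Cs, cS, θS, δS, hθS0, hθS1, hδS, hS, hSall⟩ := exists_hS_hSall_SrecAt_ctr (Lc := Lc) hL2 (2 / (Lc : ℝ) ^ 4)
  obtain ⟨Cw, cW, θW, δW, hθW0, hθW1, hδW, hW, hWall⟩ := hW_hWall_evenHalf_WrecAt_three_of_T2ev hL2 (cE := (Lc : ℝ) ^ 4) rfl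
    (ctrOff_mem_box (by omega)) (-((Lc : ℝ) ^ 8 / 2)) (2 / (Lc : ℝ) ^ 4) ((Lc : ℝ) ^ 8) (-((Lc : ℝ) ^ 12 / 4)) ((8 * (N : ℝ) ^ 2)⁻¹ • wsym22 N)
    (locStencil₂_vh₂SAn1 hLc) hT₂ hT₂d hδ₂ hθ₂0 hθ₂1
  exact exists_allScalesSeq_JsRowD1Pin_of_slots_evenHalf hLc hL2 N hS hSall hW hWall hδS hδW hθS0 hθS1 hθW0 hθW1 μ ν

end Summit.QuantumFields.BalabanUV.Beta.GAN24.WrecAtEvenHalfRowsFinal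

end
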